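import Literature.Probability.Percolation.ConditionalPositiveAssociationProofs
import Literature.Probability.Percolation.TwoClusterConditionalAssociation
import Literature.Probability.Percolation.TripodExchange
import HarnessLib
import HarnessLib.Audit.Tags

/-!
# CONJECTURE "single-edge chain rule": the source-set form of single-edge extremality on cylinder functionals —
# statement and the case of an empty avoided set (PAPER-2 track (ii): constants of the CSH family)

builds on p205010 (kernel theorem, internal audit signed; external expert review pending).  Support file (`--supports
stmt-CriticalPhenomena-4575`), seat `prim-consts-2` (gen 3); rows A6/A11 of `run/shared/lean/prim/consts/CONSTANTS.md`; memo
`run/shared/lean/prim/consts/FROM-prim-consts-2-g3-CHAIN-RULE.md`.  One `Prop` definition (an OPEN statement, tagged `@[conjecture]`),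
one theorem; no sorries; standard axioms.

For a finite weighted graph (`μ = prodBernoulli w`), a SOURCE SET `S`, an avoided set `Y` and targets `o, v` write
`a(S) = P(o ∈ C_S | S ↮ Y)`, `b(S) = P(v ∈ C_S | S ↮ Y)` (`C_S = ⋃_{s ∈ S} C_s`).  Single-edge extremality SEE
(`Consts.SingleEdgeExtremal`, OPEN) restricted to CYLINDER functionals `f = 1{C₀ ⊆ 𝐂_x}` (every minimiser found by the census is a cylinder)
is equivalent, by an elementary telescoping along the vertices of `C₀` and vdBHK monotonicity of `P(o ∈ C_{S∪v} | S∪v ↮ Y)` in `S`, to the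
following inequality between THREE source-set connection probabilities (memo §1(C)):

* `Consts.SingleEdgeChainRule` — **CONJECTURE (OPEN)**: for `S₁ = {x} ⊂ S₂ = {x,u} ⊂ S₃ = {x,u,v}`,
  `(1 − b(S₂)) · (a(S₃) − a(S₁)) ≥ (1 − b(S₁)) · (a(S₃) − a(S₂))`, stated denominator-free as
  `μ(N₁) · (μ(A₃) μ(R₂) − μ(A₂) μ(R₃)) ≤ μ(N₂) · (μ(A₃) μ(R₁) − μ(A₁) μ(R₃))` with `R_i = {S_i ↮ Y}`, `A_i = R_i ∩ {o ∈ C_{S_i}}`,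
  `N_i = R_i ∩ {v ∉ C_{S_i}}` (no side conditions: all degenerate coincidences of `x,u,v,o,Y` make both sides agree or vanish).
  Equivalent readings: the `3 × 3` determinant `det[(μN_i, μR_i, μA_i)]_{i=1,2,3} ≤ 0` (third row has `μN₃ = 0`); CONCAVITY of
  `S ↦ (1 − b(S), a(S))` at the `v`-endpoint; SUPERMULTIPLICATIVITY `p⋆_o(x,u) ≥ p⋆_v(x,u) · p⋆_o(xu,v)` of the single-pair values
  (`Consts.covD_pairOpen_cross_eq`); and, for a graph containing the pair `s(x,u)` at any weight, SEE at the functional `1{s(x,u) ∈ 𝐂_x}`.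
  EVIDENCE: exact arithmetic, ≈ 1 000 random instances `n = 6` and 60 at `n = 7` (`|Y| = 1, 2`): 0 violations; equality only when `o` hangs
  behind `v` (`a(S) = c · b(S)`) or in series gadgets.  The analogous `3 × 3` sign condition along an ARBITRARY chain `S₁ ⊂ S₂ ⊂ S₃ ∌ v`
  is FALSE (both signs occur), and so is the version with the target `o` replaced by an increasing cluster event `{o₁, o₂ ∈ C}`.
* `Consts.singleEdgeChainRule_of_isEmpty` — **THEOREM: the case `Y = ∅`** (then `μ(R_i) = 1`): `μ(A₃) − μ(A₂) = μ(o ∈ C_v, v ↮ {x,u})`,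
  `μ(A₃) − μ(A₁) ≥ μ(o ∈ C_v, v ↮ x)`, and van den Berg–Häggström–Kahn's Theorem 1.3 (increasing/decreasing case, cluster of `v` given `v ↮ x`)
  gives `μ(v ↮ x) μ(o ∈ C_v, v ↮ {x,u}) ≤ μ(o ∈ C_v, v ↮ x) μ(v ↮ {x,u})`.
[cite: VandenbergHaggstromKahn2005, Thm. 1.3 (p. 6), Thm. 1.1 (pp. 3–5)] [cite: KozmaNitzan2024, Conj. 4 (p. 32)]
-/

noncomputable section

namespace Summit.CriticalPhenomena.PercolationContinuityZ3.Theorems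

open MeasureTheory Set Literature.Probability.LatticeModels Literature.Probability.Percolation
open scoped Classical

namespace Consts

/-- **CONJECTURE — the single-edge chain rule (OPEN).**  For every finite weighted graph (`Fin n`, weights `w`, `μ = prodBernoulli w`),
vertices `x, u, v, o` and avoided set `Y`, with the source sets `S₁ = {x}`, `S₂ = {x, u}`, `S₃ = {x, u, v}` and the events
`R_i = {S_i ↮ Y}`, `A_i = R_i ∩ {o ∈ C_{S_i}}` (`= R_i ∩ ⋃_{s ∈ S_i} {s ↔ o}`), `N_i = R_i ∩ {v ∉ C_{S_i}}`:
`μ(N₁) · (μ(A₃) μ(R₂) − μ(A₂) μ(R₃)) ≤ μ(N₂) · (μ(A₃) μ(R₁) − μ(A₁) μ(R₃))`, i.e. (dividing by `μ(R₁) μ(R₂) μ(R₃)`)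
`(1 − b(S₁)) (a(S₃) − a(S₂)) ≤ (1 − b(S₂)) (a(S₃) − a(S₁))` with `a(S) = P(o ∈ C_S | S ↮ Y)`, `b(S) = P(v ∈ C_S | S ↮ Y)`.
Equivalent to single-edge extremality (`Consts.SingleEdgeExtremal`) for all cylinder functionals `1{C₀ ⊆ 𝐂_x}` (memo
FROM-prim-consts-2-g3-CHAIN-RULE.md §1(C)); TRUE for `Y = ∅` (`Consts.singleEdgeChainRule_of_isEmpty`); OPEN for `Y ≠ ∅`
(this programme, PAPER-2 consts track, 2026-08-21; exact numerics: 0 violations in ≈ 1 060 random instances `n ≤ 7`).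
[cite: VandenbergHaggstromKahn2005, Thm. 1.1 (pp. 3–5)] [status: open] -/
@[conjecture] def SingleEdgeChainRule : Prop :=
  ∀ (n : ℕ) (w : Sym2 (Fin n) → unitInterval) (x u v o : Fin n) (Y : Set (Fin n)),
    (prodBernoulli w).real ({ω : BondConfig (Fin n) | ∀ y ∈ Y, ¬ (openGraph ω).Reachable x y} ∩
          {ω | ¬ (openGraph ω).Reachable x v}) *
        ((prodBernoulli w).real
              ({ω : BondConfig (Fin n) | ∀ y ∈ Y, ¬ (openGraph ω).Reachable x y ∧ ¬ (openGraph ω).Reachable u y ∧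
                  ¬ (openGraph ω).Reachable v y} ∩ (openConn x o ∪ openConn u o ∪ openConn v o)) *
            (prodBernoulli w).real
              {ω : BondConfig (Fin n) | ∀ y ∈ Y, ¬ (openGraph ω).Reachable x y ∧ ¬ (openGraph ω).Reachable u y} -
          (prodBernoulli w).real
              ({ω : BondConfig (Fin n) | ∀ y ∈ Y, ¬ (openGraph ω).Reachable x y ∧ ¬ (openGraph ω).Reachable u y} ∩
                (openConn x o ∪ openConn u o)) *
            (prodBernoulli w).real
              {ω : BondConfig (Fin n) | ∀ y ∈ Y, ¬ (openGraph ω).Reachable x y ∧ ¬ (openGraph ω).Reachable u y ∧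
                ¬ (openGraph ω).Reachable v y}) ≤
      (prodBernoulli w).real ({ω : BondConfig (Fin n) | ∀ y ∈ Y, ¬ (openGraph ω).Reachable x y ∧ ¬ (openGraph ω).Reachable u y} ∩
          {ω | ¬ (openGraph ω).Reachable x v ∧ ¬ (openGraph ω).Reachable u v}) *
        ((prodBernoulli w).real
              ({ω : BondConfig (Fin n) | ∀ y ∈ Y, ¬ (openGraph ω).Reachable x y ∧ ¬ (openGraph ω).Reachable u y ∧
                  ¬ (openGraph ω).Reachable v y} ∩ (openConn x o ∪ openConn u o ∪ openConn v o)) *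
            (prodBernoulli w).real {ω : BondConfig (Fin n) | ∀ y ∈ Y, ¬ (openGraph ω).Reachable x y} -
          (prodBernoulli w).real ({ω : BondConfig (Fin n) | ∀ y ∈ Y, ¬ (openGraph ω).Reachable x y} ∩ openConn x o) *
            (prodBernoulli w).real
              {ω : BondConfig (Fin n) | ∀ y ∈ Y, ¬ (openGraph ω).Reachable x y ∧ ¬ (openGraph ω).Reachable u y ∧
                ¬ (openGraph ω).Reachable v y})

variable {V : Type*} [Fintype V]

/-- **THEOREM — the chain rule holds when the avoided set is empty.**  With `Y = ∅` all three avoidance events are the whole space and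
the statement reads `μ(x ↮ v) · (μ(A₃) − μ(A₂)) ≤ μ(x ↮ v, u ↮ v) · (μ(A₃) − μ(A₁))`, `A₁ = {x ↔ o}`, `A₂ = {x ↔ o} ∪ {u ↔ o}`,
`A₃ = A₂ ∪ {v ↔ o}`.  Proof: `A₃ ∖ A₂ = {v ↔ o, v ↮ x, v ↮ u}`, `A₃ ∖ A₁ ⊇ {v ↔ o, v ↮ x}`, and van den Berg–Häggström–Kahn's
Theorem 1.3 for the cluster of `v` given `v ↮ x` with the increasing `1{o ∈ C_v}` and the decreasing `1{u ∉ C_v}`: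
`μ(v ↮ x) μ(v ↔ o, v ↮ x, v ↮ u) ≤ μ(v ↔ o, v ↮ x) μ(v ↮ x, v ↮ u)`.
[cite: VandenbergHaggstromKahn2005, Thm. 1.3 (p. 6, last sentence)] -/
theorem singleEdgeChainRule_of_isEmpty (w : Sym2 V → unitInterval) (x u v o : V) :
    (prodBernoulli w).real ({ω : BondConfig V | ∀ y ∈ (∅ : Set V), ¬ (openGraph ω).Reachable x y} ∩
          {ω | ¬ (openGraph ω).Reachable x v}) *
        ((prodBernoulli w).real
              ({ω : BondConfig V | ∀ y ∈ (∅ : Set V), ¬ (openGraph ω).Reachable x y ∧ ¬ (openGraph ω).Reachable u y ∧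
                  ¬ (openGraph ω).Reachable v y} ∩ (openConn x o ∪ openConn u o ∪ openConn v o)) *
            (prodBernoulli w).real
              {ω : BondConfig V | ∀ y ∈ (∅ : Set V), ¬ (openGraph ω).Reachable x y ∧ ¬ (openGraph ω).Reachable u y} -
          (prodBernoulli w).real
              ({ω : BondConfig V | ∀ y ∈ (∅ : Set V), ¬ (openGraph ω).Reachable x y ∧ ¬ (openGraph ω).Reachable u y} ∩
                (openConn x o ∪ openConn u o)) *
            (prodBernoulli w).real
              {ω : BondConfig V | ∀ y ∈ (∅ : Set V), ¬ (openGraph ω).Reachable x y ∧ ¬ (openGraph ω).Reachable u y ∧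
                ¬ (openGraph ω).Reachable v y}) ≤
      (prodBernoulli w).real ({ω : BondConfig V | ∀ y ∈ (∅ : Set V), ¬ (openGraph ω).Reachable x y ∧ ¬ (openGraph ω).Reachable u y} ∩
          {ω | ¬ (openGraph ω).Reachable x v ∧ ¬ (openGraph ω).Reachable u v}) *
        ((prodBernoulli w).real
              ({ω : BondConfig V | ∀ y ∈ (∅ : Set V), ¬ (openGraph ω).Reachable x y ∧ ¬ (openGraph ω).Reachable u y ∧
                  ¬ (openGraph ω).Reachable v y} ∩ (openConn x o ∪ openConn u o ∪ openConn v o)) *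
            (prodBernoulli w).real {ω : BondConfig V | ∀ y ∈ (∅ : Set V), ¬ (openGraph ω).Reachable x y} -
          (prodBernoulli w).real ({ω : BondConfig V | ∀ y ∈ (∅ : Set V), ¬ (openGraph ω).Reachable x y} ∩ openConn x o) *
            (prodBernoulli w).real
              {ω : BondConfig V | ∀ y ∈ (∅ : Set V), ¬ (openGraph ω).Reachable x y ∧ ¬ (openGraph ω).Reachable u y ∧
                ¬ (openGraph ω).Reachable v y}) := by
  classical
  set μ := prodBernoulli w with hμ
  have hmeas : ∀ T : Set (BondConfig V), MeasurableSet T := fun _ => MeasurableSet.of_discrete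
  -- the three avoidance events are the whole space
  have hR1 : {ω : BondConfig V | ∀ y ∈ (∅ : Set V), ¬ (openGraph ω).Reachable x y} = univ := by ext ω; simp
  have hR2 : {ω : BondConfig V | ∀ y ∈ (∅ : Set V), ¬ (openGraph ω).Reachable x y ∧ ¬ (openGraph ω).Reachable u y} = univ := by
    ext ω; simp
  have hR3 : {ω : BondConfig V | ∀ y ∈ (∅ : Set V), ¬ (openGraph ω).Reachable x y ∧ ¬ (openGraph ω).Reachable u y ∧
      ¬ (openGraph ω).Reachable v y} = univ := by
    ext ω; simp
  rw [hR1, hR2, hR3]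
  simp only [univ_inter, probReal_univ, mul_one]
  -- names
  set A1 : Set (BondConfig V) := openConn x o with hA1
  set A2 : Set (BondConfig V) := openConn x o ∪ openConn u o with hA2
  set A3 : Set (BondConfig V) := openConn x o ∪ openConn u o ∪ openConn v o with hA3
  set N1 : Set (BondConfig V) := {ω | ¬ (openGraph ω).Reachable x v} with hN1
  set N2 : Set (BondConfig V) := {ω | ¬ (openGraph ω).Reachable x v ∧ ¬ (openGraph ω).Reachable u v} with hN2
  -- the events seen from `v`
  set Dv : Set (BondConfig V) := {ω | ∀ t ∈ ({x} : Set V), ¬ (openGraph ω).Reachable v t} with hDv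
  set Ov : Set (BondConfig V) := openConn v o with hOv
  set Uv : Set (BondConfig V) := openConn v u with hUv
  have hDvN1 : Dv = N1 := by
    ext ω
    simp only [hDv, hN1, mem_setOf_eq, mem_singleton_iff, forall_eq]
    exact ⟨fun h h' => h h'.symm, fun h h' => h h'.symm⟩
  have hDvU : Dv ∩ Uvᶜ = N2 := by
    ext ω
    simp only [hDv, hN2, hUv, mem_inter_iff, mem_setOf_eq, mem_singleton_iff, forall_eq, mem_compl_iff, openConn]
    exact ⟨fun h => ⟨fun h' => h.1 h'.symm, fun h' => h.2 h'.symm⟩, fun h => ⟨fun h' => h.1 h'.symm, fun h' => h.2 h'.symm⟩⟩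
  -- (1) `μ(A₃) − μ(A₂) = μ(Dv ∩ Ov ∩ Uvᶜ)`
  have hA23 : A2 ⊆ A3 := subset_union_left
  have hdiff32 : A3 \ A2 = Dv ∩ (Ov ∩ Uvᶜ) := by
    ext ω
    simp only [hA3, hA2, hDv, hOv, hUv, mem_sdiff, mem_union, mem_inter_iff, mem_setOf_eq, mem_singleton_iff, forall_eq,
      mem_compl_iff, openConn, not_or]
    constructor
    · rintro ⟨h3, hxo, huo⟩
      have hvo : (openGraph ω).Reachable v o := by
        rcases h3 with (h | h) | h
        · exact absurd h hxo
        · exact absurd h huo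
        · exact h
      exact ⟨fun hvx => hxo (hvx.symm.trans hvo), hvo, fun hvu => huo (hvu.symm.trans hvo)⟩
    · rintro ⟨hvx, hvo, hvu⟩
      exact ⟨Or.inr hvo, fun hxo => hvx (hvo.trans hxo.symm), fun huo => hvu (hvo.trans huo.symm)⟩
  have e32 : μ.real A3 - μ.real A2 = μ.real (Dv ∩ (Ov ∩ Uvᶜ)) := by
    have h := measureReal_sdiff (μ := μ) hA23 (hmeas A2)
    rw [hdiff32] at h; exact h.symm
  -- (2) `μ(A₃) − μ(A₁) ≥ μ(Dv ∩ Ov)`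
  have hA13 : A1 ⊆ A3 := fun ω h => Or.inl (Or.inl h)
  have hsub31 : Dv ∩ Ov ⊆ A3 \ A1 := by
    rintro ω ⟨hvx, hvo⟩
    simp only [hDv, mem_setOf_eq, mem_singleton_iff, forall_eq] at hvx
    refine ⟨Or.inr hvo, fun hxo => hvx ((show (openGraph ω).Reachable v o from hvo).trans
      (show (openGraph ω).Reachable x o from hxo).symm)⟩
  have e31 : μ.real (Dv ∩ Ov) ≤ μ.real A3 - μ.real A1 := by
    have h := measureReal_sdiff (μ := μ) hA13 (hmeas A1)
    rw [← h]; exact measureReal_mono hsub31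
  -- (3) vdBHK Thm 1.3 (increasing / decreasing) for the cluster of `v` given `v ↮ x`
  have hvx : v ∉ ({x} : Set V) ∨ v ∈ ({x} : Set V) := em' _
  rcases hvx with hvx | hvx
  swap
  · -- degenerate `v = x`: `N1 = N2 ∩ … = ∅`-type: both `N` events are empty
    have hvx' : v = x := by simpa using hvx
    subst hvx'
    have hN1e : N1 = ∅ := by
      ext ω; simp only [hN1, mem_setOf_eq, mem_empty_iff_false, iff_false, not_not]; exact SimpleGraph.Reachable.refl _
    have hN2e : N2 = ∅ := by
      ext ω; simp only [hN2, mem_setOf_eq, mem_empty_iff_false, iff_false, not_and, not_not]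
      exact fun h => absurd (SimpleGraph.Reachable.refl _) h
    rw [hN1e, hN2e]; simp
  set F : Set (Sym2 V) → ℝ := connIndicatorFn v o with hF
  set G : Set (Sym2 V) → ℝ := fun C => 1 - connIndicatorFn v u C with hG
  have hFm : Monotone F := monotone_connIndicatorFn v o
  have hGa : Antitone G := fun C C' hCC' => by
    simp only [hG]; linarith [monotone_connIndicatorFn v u hCC']
  have key := BHK2006_clusterConditionalPositiveAssociation.antitone_right BHK2006_clusterConditionalPositiveAssociation_holds
    V w v {x} F G hFm hGa hvx
  -- read the integrals as measures
  have hFω : ∀ ω : BondConfig V, F (openEdgeCluster ω v) = Ov.indicator 1 ω := fun ω => connIndicatorFn_openEdgeCluster ω v o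
  have hGω : ∀ ω : BondConfig V, G (openEdgeCluster ω v) = (Uvᶜ).indicator 1 ω := by
    intro ω
    simp only [hG, connIndicatorFn_openEdgeCluster]
    by_cases h : ω ∈ Uv
    · rw [indicator_of_mem h, indicator_of_notMem (fun h' => (Set.mem_compl_iff _ _).mp h' h)]; simp
    · rw [indicator_of_notMem h, indicator_of_mem (show ω ∈ Uvᶜ from h)]; simp
  simp only [hFω, hGω, TripodExchange.setIntegral_indicator_one_eq, TripodExchange.setIntegral_indicator_mul_indicator_eq] at key
  -- key : μ.real Dv * μ.real (Dv ∩ (Ov ∩ Uvᶜ)) ≤ μ.real (Dv ∩ Ov) * μ.real (Dv ∩ Uvᶜ)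
  rw [hDvU] at key
  rw [e32, ← hDvN1]
  have hN2n : 0 ≤ μ.real N2 := measureReal_nonneg
  calc μ.real Dv * μ.real (Dv ∩ (Ov ∩ Uvᶜ)) ≤ μ.real (Dv ∩ Ov) * μ.real N2 := key
    _ ≤ (μ.real A3 - μ.real A1) * μ.real N2 := mul_le_mul_of_nonneg_right e31 hN2n
    _ = μ.real N2 * (μ.real A3 - μ.real A1) := mul_comm _ _

end Consts

end Summit.CriticalPhenomena.PercolationContinuityZ3.Theorems

end
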